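import Summits.Ventures.HodgeRepro2.T5SU11SphericalDecayAsymptotic

/-!
# The reflection `λ ↦ 2 − λ`: the second and the decaying solutions for `λ < 1`

The spherical function is invariant under the reflection of the spectral parameter about `ρ = 1`,
`φ_λ = φ_{2−λ}` (row 33x's `sph_two_sub_hyp`), and so is the radial equation (`λ(λ − 2) = (2 − λ)((2 − λ) − 2)`).
Hence the reduction-of-order companion and the decaying solution of rows 444 and 448 are reflection-invariant as
functions — `ψ_{2−λ} = ψ_λ` (`sphSecond_two_sub`), `χ_{2−λ} = χ_λ` (`sphDecay_two_sub`) — and everything proved for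
`λ > 1` transfers to **`λ < 1`** through `2 − λ > 1`: `χ_{2−λ}` is a positive solution of the radial equation at
the parameter `λ` (`sphDecay_two_sub_ode`, `sphDecay_two_sub_pos`), with `χ_{2−λ}/φ_λ → 0`
(`tendsto_sphDecay_two_sub_div_atTop`), unique up to a constant (`eq_const_mul_sphDecay_two_sub_of_tendsto`), and
with the exact rate `e^{(2−λ)t} χ_{2−λ}(t) → 1/((1 − λ) c(λ))` (`tendsto_exp_mul_sphDecay_two_sub`). Nothing is
claimed about (N).

Blind lane: Mathlib + the HodgeRepro2 prefix only; no sorry; axioms ⊆ {propext, Classical.choice,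
Quot.sound}.
-/

namespace Summit.Ventures.HodgeRepro2.T5SU11SphericalReflection

open Filter Topology
open T5SU11Cartan T5SU11SphericalFunction T5SU11SphericalSymmetry T5SU11SphericalAsymptotic
  T5SU11ReductionOfOrder T5SU11ReductionOfOrderInfinity T5SU11SphericalSolutionSpaceAll T5SU11SphericalDecay
  T5SU11SphericalDecayAsymptotic

/-- The radial equation at `λ` is the radial equation at `2 − λ`. -/
theorem mul_sub_two_two_sub (lam : ℝ) : (2 - lam) * ((2 - lam) - 2) = lam * (lam - 2) := by ring

section measure

variable [MeasurableSpace Circle] [BorelSpace Circle]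

/-- `φ_{2−λ} ∘ a = φ_λ ∘ a` as functions. -/
theorem sph_hyp_two_sub_fun (lam : ℝ) : (fun t => sph (2 - lam) (hyp t)) = fun t => sph lam (hyp t) :=
  funext fun t => (sph_two_sub_hyp lam t).symm

/-- **`ψ_{2−λ} = ψ_λ`.** -/
theorem sphSecond_two_sub (lam : ℝ) : sphSecond (2 - lam) = sphSecond lam := by
  funext t
  unfold sphSecond
  rw [sph_hyp_two_sub_fun]

/-- **`χ_{2−λ} = χ_λ`.** -/
theorem sphDecay_two_sub (lam : ℝ) : sphDecay (2 - lam) = sphDecay lam := by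
  funext t
  unfold sphDecay
  rw [sph_hyp_two_sub_fun]

/-- `χ_{2−λ}′ = χ_λ′`. -/
theorem sphDecay'_two_sub (lam : ℝ) : sphDecay' (2 - lam) = sphDecay' lam := by
  funext t
  unfold sphDecay'
  rw [sph_hyp_two_sub_fun]

/-- `χ_{2−λ}″ = χ_λ″`. -/
theorem sphDecay''_two_sub (lam : ℝ) : sphDecay'' (2 - lam) = sphDecay'' lam := by
  funext t
  unfold sphDecay''
  rw [sph_hyp_two_sub_fun]

/-! ### The decaying solution for `λ < 1` -/

/-- **`χ_{2−λ} > 0`** for `λ < 1`. -/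
theorem sphDecay_two_sub_pos {lam : ℝ} (hlam : lam < 1) {t : ℝ} (ht : 0 < t) : 0 < sphDecay (2 - lam) t :=
  sphDecay_pos (by linarith) ht

/-- **`χ_{2−λ}` solves the radial equation at the parameter `λ`** for `λ < 1`. -/
theorem sphDecay_two_sub_ode {lam : ℝ} (hlam : lam < 1) {t : ℝ} (ht : 0 < t) :
    Real.sinh (2 * t) * sphDecay'' (2 - lam) t + 2 * Real.cosh (2 * t) * sphDecay' (2 - lam) t
      = lam * (lam - 2) * Real.sinh (2 * t) * sphDecay (2 - lam) t := by
  rw [← mul_sub_two_two_sub]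
  exact sphDecay_ode (by linarith) ht

/-- **The Wronskian against `φ_λ`** for `λ < 1`: `sinh 2t · (φ_λ χ_{2−λ}′ − φ_λ′ χ_{2−λ}) = −1`. -/
theorem wronskian_sphDecay_two_sub {lam : ℝ} (hlam : lam < 1) {t : ℝ} (ht : 0 < t) :
    Real.sinh (2 * t) * (sph lam (hyp t) * sphDecay' (2 - lam) t
      - deriv (fun t => sph lam (hyp t)) t * sphDecay (2 - lam) t) = -1 := by
  have h := wronskian_sphDecay (lam := 2 - lam) (by linarith) ht
  rw [← sph_hyp_two_sub_fun lam, sph_two_sub_hyp lam t]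
  exact h

/-- **`χ_{2−λ}/φ_λ → 0`** for `λ < 1`. -/
theorem tendsto_sphDecay_two_sub_div_atTop {lam : ℝ} (hlam : lam < 1) :
    Tendsto (fun t => sphDecay (2 - lam) t / sph lam (hyp t)) atTop (𝓝 0) := by
  have h := tendsto_sphDecay_div_atTop (lam := 2 - lam) (by linarith)
  exact h.congr (fun t => by rw [sph_two_sub_hyp lam t])

/-- **Uniqueness for `λ < 1`**: a solution of the radial equation at `λ` with `u/φ_λ → 0` is a constant multiple
of `χ_{2−λ}`. -/
theorem eq_const_mul_sphDecay_two_sub_of_tendsto {lam : ℝ} (hlam : lam < 1) {u u' u'' : ℝ → ℝ}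
    (hu : ∀ t, 0 < t → HasDerivAt u (u' t) t) (hu' : ∀ t, 0 < t → HasDerivAt u' (u'' t) t)
    (hode : ∀ t, 0 < t → Real.sinh (2 * t) * u'' t + 2 * Real.cosh (2 * t) * u' t
      = lam * (lam - 2) * Real.sinh (2 * t) * u t)
    (hdecay : Tendsto (fun t => u t / sph lam (hyp t)) atTop (𝓝 0)) :
    ∃ c : ℝ, ∀ t, 0 < t → u t = c * sphDecay (2 - lam) t := by
  have hode' : ∀ t, 0 < t → Real.sinh (2 * t) * u'' t + 2 * Real.cosh (2 * t) * u' t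
      = (2 - lam) * ((2 - lam) - 2) * Real.sinh (2 * t) * u t := by
    intro t ht
    rw [mul_sub_two_two_sub]
    exact hode t ht
  have hdecay' : Tendsto (fun t => u t / sph (2 - lam) (hyp t)) atTop (𝓝 0) :=
    hdecay.congr (fun t => by rw [sph_two_sub_hyp lam t])
  exact exists_eq_const_mul_sphDecay_of_tendsto (by linarith) hu hu' hode' hdecay'

/-- **The exact rate for `λ < 1`**: `e^{(2−λ)t} χ_{2−λ}(t) → 1/((1 − λ) c(λ))`. -/
theorem tendsto_exp_mul_sphDecay_two_sub {lam : ℝ} (hlam : lam < 1) :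
    Tendsto (fun t => Real.exp ((2 - lam) * t) * sphDecay (2 - lam) t) atTop (𝓝 (1 / ((1 - lam) * cfun lam))) := by
  have h := tendsto_exp_mul_sphDecay (lam := 2 - lam) (by linarith)
  rwa [show (2 : ℝ) - lam - 1 = 1 - lam by ring, show (2 : ℝ) - (2 - lam) = lam by ring] at h

end measure

end Summit.Ventures.HodgeRepro2.T5SU11SphericalReflection
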